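import Summits.CriticalPhenomena.PercolationContinuityZ3.Theorems.PercNearOneGluingNoHeavyLowerTailCertConst
import HarnessLib

/-!
# `NoHeavyLowerTail` (stmt-CriticalPhenomena-4575) — certificate machine, part 6:
# bucket-local term generation (the same check, cheaper for the kernel)

Support file (depth prover nh-dp-blobmono gen 3; `--supports stmt-CriticalPhenomena-4575`).  Computable definitions +
equations; no named facts, no sorries, standard axioms.

`CertCheck.checkCB` (part 5) expands ALL terms of a certificate and then keeps one bucket; for large certificates
(the three-relay event gluing EG₃ at constant `7/6`: ≈ 2.6·10⁵ raw monomials in 48 buckets) the kernel then rebuilds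
the full term list in every bucket declaration.  Here the bucket test is pushed INTO the generators
(`linTermsB`, `pairTermsB`: a term is allocated only if it belongs to the bucket), and `checkCBf` is proved EQUAL to
`checkCB` (`checkCBf_eq`, `Cert.checkCBf_eq`) — so data files evaluate `checkCBf` by `decide` and conclude with the
soundness theorems of parts 3 and 5 unchanged.
-/

namespace Summit.CriticalPhenomena.PercolationContinuityZ3.Theorems

namespace CertCheck

/-- Bucket-local linear expansion: only the terms of bucket `b`. [folklore] -/
def linTermsB (nb b : ℕ) (e mult : List ℕ) (wt : ℕ) : List Term :=
  (e.filter fun i => (i + mult.sum) % nb == b).map fun i => (monoIns i mult, wt)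

/-- Bucket-local product expansion: only the terms of bucket `b`. [folklore] -/
def pairTermsB (nb b : ℕ) (e e' mult : List ℕ) (wt : ℕ) : List Term :=
  e.flatMap fun i => (e'.filter fun j => (i + (j + mult.sum)) % nb == b).map fun j => (monoIns i (monoIns j mult), wt)

/-- Bucket-local plus side. [folklore] -/
def plusTermsB (nb b : ℕ) (L : List ℕ) (rows : List Row) (al : List ATerm) : List Term :=
  (al.flatMap fun a => linTermsB nb b L a.mult a.wt) ++ rows.flatMap fun r => pairTermsB nb b r.e3 r.e4 r.mult r.wt

/-- Bucket-local minus side. [folklore] -/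
def minusTermsB (nb b : ℕ) (U : ℕ → List ℕ) (rows : List Row) (al : List ATerm) : List Term :=
  (al.flatMap fun a => linTermsB nb b (U a.ref) a.mult a.wt) ++
    rows.flatMap fun r => pairTermsB nb b r.e1 r.e2 r.mult r.wt

/-- THE FAST BUCKETED CHECK with constant `p/q` (equal to `checkCB`, see `checkCBf_eq`). [folklore] -/
def checkCBf (p q nb b : ℕ) (L : List ℕ) (U : ℕ → List ℕ) (rows : List Row) (al : List ATerm) : Bool :=
  dominated (normalize (plusTermsB nb b L rows (scaleAl q al))) (normalize (minusTermsB nb b U rows (scaleAl p al)))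

/-- The index sum of a monomial after insertion. [folklore] -/
theorem sum_monoIns (a : ℕ) (l : List ℕ) : (monoIns a l).sum = a + l.sum := by
  induction l with
  | nil => simp [monoIns]
  | cons b l ih =>
    unfold monoIns
    cases Nat.ble a b
    · simp only [cond_false, List.sum_cons, ih]; omega
    · simp

/-- Filtering a `flatMap` is `flatMap` of the filtered pieces. [folklore] -/
theorem filter_flatMap' {α β : Type*} (l : List α) (f : α → List β) (p : β → Bool) :
    (l.flatMap f).filter p = l.flatMap fun a => (f a).filter p := by
  induction l with
  | nil => simp
  | cons a l ih => rw [List.flatMap_cons, List.filter_append, ih, List.flatMap_cons]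

/-- The bucket-local linear expansion is the bucket of the linear expansion. [folklore] -/
theorem linTermsB_eq (nb b : ℕ) (e mult : List ℕ) (wt : ℕ) :
    linTermsB nb b e mult wt = (linTerms e mult wt).filter fun t => bucket nb t == b := by
  unfold linTermsB linTerms
  rw [List.filter_map]
  congr 1
  refine List.filter_congr fun i _ => ?_
  simp only [Function.comp, bucket, sum_monoIns]

/-- The bucket-local product expansion is the bucket of the product expansion. [folklore] -/
theorem pairTermsB_eq (nb b : ℕ) (e e' mult : List ℕ) (wt : ℕ) :
    pairTermsB nb b e e' mult wt = (pairTerms e e' mult wt).filter fun t => bucket nb t == b := by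
  unfold pairTermsB pairTerms
  rw [filter_flatMap']
  congr 1
  funext i
  rw [List.filter_map]
  congr 1
  refine List.filter_congr fun j _ => ?_
  simp only [Function.comp, bucket, sum_monoIns]

/-- The bucket-local plus side is the bucket of the plus side. [folklore] -/
theorem plusTermsB_eq (nb b : ℕ) (L : List ℕ) (rows : List Row) (al : List ATerm) :
    plusTermsB nb b L rows al = (plusTerms L rows al).filter fun t => bucket nb t == b := by
  unfold plusTermsB plusTerms
  rw [List.filter_append, filter_flatMap', filter_flatMap']
  simp only [linTermsB_eq, pairTermsB_eq]

/-- The bucket-local minus side is the bucket of the minus side. [folklore] -/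
theorem minusTermsB_eq (nb b : ℕ) (U : ℕ → List ℕ) (rows : List Row) (al : List ATerm) :
    minusTermsB nb b U rows al = (minusTerms U rows al).filter fun t => bucket nb t == b := by
  unfold minusTermsB minusTerms
  rw [List.filter_append, filter_flatMap', filter_flatMap']
  simp only [linTermsB_eq, pairTermsB_eq]

/-- **The fast check is the check.** [folklore] -/
theorem checkCBf_eq (p q nb b : ℕ) (L : List ℕ) (U : ℕ → List ℕ) (rows : List Row) (al : List ATerm) :
    checkCBf p q nb b L U rows al = checkCB p q nb b L U rows al := by
  unfold checkCBf checkCB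
  rw [plusTermsB_eq, minusTermsB_eq]

end CertCheck

namespace CertCells

/-- The fast bucketed kernel check of a certificate with constant `p/q`. [folklore] -/
def Cert.checkCBf (C : Cert) (p q nb b : ℕ) : Bool :=
  CertCheck.checkCBf p q nb b (cellsOf C.L) C.Ucells (C.rows.map RowSpec.toRow) C.al

/-- **The fast check is the check** (certificate level). [folklore] -/
theorem Cert.checkCBf_eq (C : Cert) (p q nb b : ℕ) : C.checkCBf p q nb b = C.checkCB p q nb b :=
  CertCheck.checkCBf_eq p q nb b _ _ _ _

/-- From fast bucket checks to the hypothesis of `Cert.existsC_le_of_injective`. [folklore] -/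
theorem Cert.checkCB_of_checkCBf (C : Cert) (p q nb : ℕ) (h : ∀ b < nb, C.checkCBf p q nb b = true) :
    ∀ b < nb, C.checkCB p q nb b = true := fun b hb => by
  rw [← Cert.checkCBf_eq]; exact h b hb

end CertCells

end Summit.CriticalPhenomena.PercolationContinuityZ3.Theorems
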